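import Mathlib
import HarnessLib
import HarnessLib.Audit
import Summits.Langlands.Statement
import Literature.NumberTheory.GaloisRepresentations.PstCrystallineExtensionData
import Literature.NumberTheory.GaloisRepresentations.PstWeilDeligneCyclotomicPowersWeights
import Literature.NumberTheory.Automorphic.HilbertModularGaloisRep
import Literature.NumberTheory.Automorphic.HilbertModularLocalGlobal
import Literature.NumberTheory.Automorphic.IsAutomorphicAE
import Literature.NumberTheory.Automorphic.LocalLanglandsDatumProofs
import HarnessLib.Audit.Status.Attr

/-!
Route: WachComponentCensus

# Route WachComponentCensus — Wach-module component census ⇒ potential diagonalisability for GL₂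
over unramified p-adic fields in every weight ⇒ PD-free lifting at unramified p

It suffices to show PD2Unram (card wach-module-component-census, the spine and only card): for every
prime p ≥ 5 and every finite UNRAMIFIED K/ℚ_p, every crystalline ρ : G_K → GL₂(ℚ̄_p) with regular
labelled Hodge–Tate weights is potentially diagonalisable (BarnetlambEtAl2014 §1.4: "as far as we
know they could all be"), proved by a certified COMPONENT CENSUS of the fixed-weight framed
crystalline deformation spaces X_λ(ρ̄) = Spec R^{□,cris,λ}(ρ̄)[1/p] in UNBOUNDED weight, organised
by the planner's dichotomy (CORRECTING the card's Conjecture C, which is false as stated): if ρ̄ is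
λ-SEEDED (its deformation space over the unramified quadratic extension contains a lift with a
stable line or a direct sum of crystalline characters — forcing ρ̄^ss|I to be of the top
Bhatt–Gee–Kisin type τ(λ, w), arXiv:2607.08660) and ρ̄ is IRREDUCIBLE the seeds are unramified and
non-ordinary (that sector's own UNRAMIFIED Wach-module seed census, LambdaTypeSeedsIrred
stmt-Langlands-13889 with ReducibleNonOrdinaryReach stmt-Langlands-13900, is an alternative
decomposition of PD2Unram on a sub-sector and was CARVED OUT of this route's thesis on 2026-08-16 —
route-choice crux-cap, operator hold — as the sibling thesis 'WachSeedCensus', to be opened as its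
own route; its items stay listed below as non-crux supports only until the operator's drop, which
the gate's route.multi-assembly deadlock on stmt-Langlands-14681 denies to planner edits; it is not
load-bearing here, because the mechanism below treats every non-ordinary point alike); if ρ̄ is of
SHADOW type (τ(λ', w), λ' ↑ λ, λ' ≠ λ — these appear exactly when some gap k_τ − 1 ≥ p + 1, e.g.
V̄_{p+2,a_p} = ind(ω₂²) for 0 < v(a_p) < 1, BuzzardGee2009) no seed exists over any unramified field
— nor, for reducible ρ̄, on its non-ordinary components — and potential diagonalisability must be
certified over an ADMISSIBLE Gee–Kisin trivialising field L′ ⊇ K^{ker ρ̄}(ζ_p, (−p)^{1/(p^f−1)})·K₂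
(one whose space X_{λ_{L′}}(trivial) carries a NON-ordinary trivial-reduction diagonal point;
'extending L if necessary', since the cr-ordinary locus is open-closed) by reaching a non-ordinary
DIAGONAL point of X_{λ_{L′}}(trivial) from EVERY non-ordinary point of every X_λ(ρ̄) — λ-seeded or
shadow, ρ̄ reducible or not (TrivialFieldReachabilityR, the single mechanism of this route, repaired
after the refutation of the pinned-field version stmt-Langlands-14504; the one printed instance is
GeeKisin2014 Lemma 3.4.1, pot-BT ⇒ PD, via Kisin's connectivity of the non-ordinary Barsotti–Tate
locus of the trivial representation), with the first open weight k = p + 2 (ShadowPDWeightPplus2)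
and the first residually-reducible non-ordinary weight k = 3p over the tame field ℚ_p(ζ_p)
(ReduciblePDWeight3p) as the calibrated entry points; ordinary points are PD in print
(BarnetlambEtAl2014 Lemma 1.4.3(1)). Reductions are computed by Wach modules over unramified fields
(Rozensztajn2018, Dousmanis2010, Guzman2024) and by Breuil–Kisin modules over the tamely ramified L′
(CarusoLubicz2013-type). With the printed potentially-diagonalisable automorphy-lifting theorems
(BarnetlambEtAl2014 Thm 4.2.1, BarnetlambGeeGeraghty2013MathAnn Thm 3.1.2 / Thm A.4.1,
BarnetlambGeeGeraghty2013MRL Thm 2.1.2, GeeKisin2014 Lemma 3.4.1; support PDChain) PD2Unram gives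
the typed target LiftB2Unram: the direction-(B) lifting slice of the summit for n = 2 over totally
real F at primes p ≥ 7 UNRAMIFIED in F, in EVERY regular weight and for ANY residue degrees f_v,
with no p-adic local Langlands input; typed cruxes split it by residue degree (all f_v ≤ 2 = the
certified-census range, some f_v ≥ 3 = extrapolation by families), and the declared out-of-scope
remainder SliceToLanglands carries it to `Langlands`.
Lean: `∀ (F : Type) [Field F] [NumberField F] [NumberField.IsTotallyReal F] (p : ℕ) [Fact p.Prime],
7 ≤ p → ¬ ((p : ℤ) ∣ NumberField.discr F) → ∃ RD : ReciprocityData F, (∀ (m : ℤ) (χ :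
Literature.NumberTheory.GaloisRepresentations.FramedGaloisRep F (PadicAlgCl p) 1), (∀ σ, (χ σ).val 0
0 = algebraMap ℚ_[p] (PadicAlgCl p)
((((Literature.NumberTheory.GaloisRepresentations.GaloisRep.cyclotomicCharacter F p σ : ℤ_[p]ˣ) :
ℤ_[p]) : ℚ_[p]) ^ m)) → ∀ (v : IsDedekindDomain.HeightOneSpectrum (NumberField.RingOfIntegers F))
(hv : ((p : ℕ) : NumberField.RingOfIntegers F) ∈ v.asIdeal), let D := RD.pst p v hv; letI :=
D.algebra; ∀ τ : v.adicCompletion F →ₐ[ℚ_[p]] PadicAlgCl p, χ.labelledHodgeTateWeightsAt v D.algebra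
D.𝔅 τ.toRingHom = {-m}) ∧ ∀ hcpt :
Literature.NumberTheory.Automorphic.isCompact_glFiniteIntegralLevel 2 F, (∀ π :
Literature.NumberTheory.Automorphic.CuspidalAutomorphicRepData 2 F hcpt, π.1.IsLAlgebraic → (∃ T :
Literature.NumberTheory.Automorphic.InfinityType F 2, π.1.HasInfinityType T ∧ T.IsRegular) → ∀ (ℓ :
ℕ) [Fact ℓ.Prime] (ι : PadicAlgCl ℓ ≃+* ℂ), ∃ ρ :
Literature.NumberTheory.GaloisRepresentations.FramedGaloisRep F (PadicAlgCl ℓ) 2,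
ρ.toGaloisRep.IsIrreducible ∧ IsGeometricFramed RD ρ ∧ Corresponds RD ι π.1 ρ) ∧ (∀ (ι : PadicAlgCl
p ≃+* ℂ) (ρ : Literature.NumberTheory.GaloisRepresentations.FramedGaloisRep F (PadicAlgCl p) 2),
ρ.toGaloisRep.IsIrreducible → IsGeometricFramed RD ρ → ρ.IsOdd → (∀ (v :
IsDedekindDomain.HeightOneSpectrum (NumberField.RingOfIntegers F)) (hv : ((p : ℕ) :
NumberField.RingOfIntegers F) ∈ v.asIdeal), let D := RD.pst p v hv; D.IsCrystallineFramed (ρ.toLocal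
v) ∧ (letI := D.algebra; ∀ τ : v.adicCompletion F →ₐ[ℚ_[p]] PadicAlgCl p, let M :=
ρ.labelledHodgeTateWeightsAt v D.algebra D.𝔅 τ.toRingHom; M.Nodup ∧ Multiset.card M = 2)) → (¬ ∃ χ₁
χ₂ : Field.absoluteGaloisGroup (CyclotomicField p F) →* (PadicAlgCl p)ˣ, IsOpen (χ₁.ker : Set
(Field.absoluteGaloisGroup (CyclotomicField p F))) ∧ IsOpen (χ₂.ker : Set (Field.absoluteGaloisGroup
(CyclotomicField p F))) ∧ ∀ σ, ‖(ρ.restrictField (CyclotomicField p F) σ).val.trace - ((χ₁ σ :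
PadicAlgCl p) + (χ₂ σ : PadicAlgCl p))‖ < 1) → (∃ (π₀ :
Literature.NumberTheory.Automorphic.CuspidalAutomorphicRepData 2 F hcpt) (ρ₀ :
Literature.NumberTheory.GaloisRepresentations.FramedGaloisRep F (PadicAlgCl p) 2), π₀.1.IsLAlgebraic
∧ (∃ T : Literature.NumberTheory.Automorphic.InfinityType F 2, π₀.1.HasInfinityType T ∧ T.IsRegular)
∧ Corresponds RD ι π₀.1 ρ₀ ∧ ∀ σ, ‖(ρ σ).val.trace - (ρ₀ σ).val.trace‖ < 1) → ∃ π :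
Literature.NumberTheory.Automorphic.CuspidalAutomorphicRepData 2 F hcpt, π.1.IsLAlgebraic ∧
Corresponds RD ι π.1 ρ)`

## Assembly
Typed layer (crux-only deciding theorem, D-0027 §2.1, installed 2026-08-16): `closes :
LiftB2UnramSmallF → LiftB2UnramLargeF → SliceToLanglands → Langlands` — the residue-degree case
split (every place above p has residue field of size ≤ p², or some place has a larger one) that
turns the two typed crux slices into the target LiftB2Unram is carried out INSIDE the proof
(by_cases; lean check rc 0, h21_check_closes ok, axioms propext / Classical.choice / Quot.sound), so
LiftB2Unram is DERIVED, not assumed (kind target), the bookkeeping item Assembly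
(stmt-Langlands-12046, `LiftB2UnramSmallF → LiftB2UnramLargeF → LiftB2Unram`, candidate proof
attached by grounder g22-25) is no longer a hypothesis, and the declared remainder SliceToLanglands
: LiftB2Unram → Langlands is a CRUX (rank 9; a remainder may only enter `closes` as a crux). The
MATHEMATICAL assembly is the informal support PDChain (stmt-Langlands-14681; every arrow in print
except the reachability input): TrivialFieldReachabilityR (every non-ordinary point of every
X_λ(ρ̄), K unramified, any f: a non-ordinary diagonal point on its component over each admissible
trivialising field; first shadow weight = ShadowPDWeightPplus2, first residually-reducible
non-ordinary weight = ReduciblePDWeight3p) + BarnetlambEtAl2014 Lemma 1.4.3(1) for ordinary points ⇒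
(Kisin2007 Thm 3.3.8 + BLGGT §1.4 calculus + the GeeKisin2014 Lemma 3.4.1 pattern) PD2Unram: PD of
every 2-dimensional crystalline representation of every unramified K with regular weights ⇒
(BarnetlambGeeGeraghty2013MathAnn Thm 3.1.2 / A.4.1 after solvable base change to a CM field,
GeeKisin2014 Lemma 3.4.1 (= published 4.4.1) for the PD automorphic lift of ρ̄, BarnetlambEtAl2014
Thm 4.2.1, descent) LiftB2UnramSmallF and LiftB2UnramLargeF alike (the f ≤ 2 / f ≥ 3 cut separates
the certified-computation range from the extrapolation range, not two mechanisms); the conjoined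
(A)-direction turns weak automorphy into Corresponds (Chebotarev + Brauer–Nesbitt).

Rationale: WHY THIS LINE. At ℓ = p every patching-based lifting theorem needs r|G_{F_v} on the same component
of the local crystalline deformation ring as an automorphic lift
(Literature.Barriers.Langlands.PatchingLocalComponentBarrier); BLGGT's printed escape clause is
potential diagonalisability (PD), known only for ordinary lifts (BarnetlambEtAl2014 Lemma 1.4.3(1)),
Fontaine–Laffaille / HT gaps ≤ p−1 (GaoLiu2014), n = 2 weights in [0, p] (Bartlett2020), potentially
Barsotti–Tate (GeeKisin2014 Lemma 4.4.1), n = 3 minimal weight (BartlettLeHungLevin2026), and — in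
SOME regular weight for every ρ̄ — Emerton–Gee's lifts (arXiv:1908.07185 Thm 6.4.4); all
fixed-weight PD theorems stop at HT gaps ≤ p because they use local models. The mechanism imports
computational / integral p-adic Hodge theory (Wach modules exist in EVERY weight exactly because K
is unramified: Berger; explicit rank-2 families over ℚ_{p^f}: Dousmanis2010, Guzman2024,
arXiv:0807.1078; exact reduction algorithms: Rozensztajn2018 for f = 1, CarusoLubicz2013
Breuil–Kisin; local constancy Berger2011 / arXiv:2005.01212; the all-weight constraint λ ↑ μ on
reductions, arXiv:2607.08660 Thm 1.2) and the rigid geometry of generic fibres (Kisin2007 Thm 3.3.8: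
formally smooth, so irreducible = connected components; Rozensztajn2020 Thms 1–3: for K = ℚ_p the
locus X(k, ρ̄) is a standard subset of the a_p-disc, finitely determined) to decide PD component by
component, where p-adic local Langlands is unavailable (ModPLanglandsGL2BeyondQpFpBar). CORRECTION
found while filing (planner, NOTES.md §CORRECTION): reducible or induced seeds of weight λ exist
only for λ-seeded residual representations (top Bhatt–Gee–Kisin type, arXiv:2607.08660); for shadow
types (present as soon as a gap is ≥ p+1, BuzzardGee2009 Thm 1.6) every seed lives over the ramified
Gee–Kisin trivialising field (GeeKisin2014 Lemma 3.4.1 pattern, Kisin2009 Cor 2.5.16), where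
Breuil–Kisin modules replace Wach modules; the cruxes are re-cut along this dichotomy
(TrivialFieldReachability #2, ShadowPDWeightPplus2 #3, LambdaTypeSeeds #4, PD2Unram #7). SECOND
CORRECTION (route-repair 2026-08-15, refuter crux-attacks on stmt-Langlands-14504/14580, evidence on
those items): ONE open-closed invariant — the cr-ordinary locus of a fixed-weight crystalline
deformation space is a union of components (BarnetlambEtAl2014 §1.4 p.13; one component for ρ̄ = 𝟙)
— makes the pinned trivialising field too small when all its trivial-reduction diagonal points are
ordinary (p = 7, λ = (0,11), ρ̄ = ω⁴ ⊕ ω, L = ℚ_49(ζ_7)) and leaves reducible λ-seeded ρ̄ with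
seed-free non-ordinary components over every unramified field (p = 5, k = 15); the heart is restated
as TrivialFieldReachabilityR (#2: every NON-ORDINARY point reaches a non-ordinary diagonal point
over every ADMISSIBLE trivialising field — GeeKisin2014 L.3.4.1 'extending L if necessary'), #4 as
LambdaTypeSeedsIrred + ReducibleNonOrdinaryReach (parallel unit). THIRD (route-choice 2026-08-16,
operator hold crux-cap after the auto-crux of LiftB2Unram made 8 cruxes): the route carried TWO
theses — the trivialising-field reachability line (#2 with its calibrated first instances #3, #3b),
which alone implies PD2Unram, and the #4 family (unramified Wach seed census for irreducible λ-type
ρ̄ + reducible non-ordinary reach), an ALTERNATIVE decomposition of PD2Unram on a sub-sector that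
`closes` never needed; the thesis is SPLIT: this route keeps the reachability line and the typed
layer, the #4 family is carved out as the sibling thesis 'WachSeedCensus' (stmt-Langlands-13889,
13900: re-badged non-crux here, evidence intact, to be re-filed verbatim when that route is opened —
spec in the route-choice planner's folder, sibling-WachSeedCensus.md — and DROPPED from this route
by the operator: every planner `--drop` bounces on route.multi-assembly because PDChain
stmt-Langlands-14681 carries a keyword-derived `assembly` badge that can be neither retriaged,
dropped, nor restated without a Lean statement), together with the settled debris awaiting the same
operator drop (14580 refuted-misstated, 13901 duplicate, 13884 probe, 14504 refuted-misstated
original of #2). What it does that other routes do not: TriangulineChamber (open) attacks the same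
all-weight sector by per-type irreducibility of the trianguline variety and p-adic interpolation
ACROSS weights and needs a residual genericity hypothesis; this line works weight by weight, needs
no genericity, and yields PD — a LOCAL structural fact usable at any number of places with any
residue degrees (LiftB2Unram ⇒ TriangulineChamber.LiftB2CrysUnramifiedP). Matsumoto
(arXiv:2512.04641 Thm 1.2/1.5) gives all-weight lifting when every F_v ∈ {ℚ_p, ℚ_{p²}} and ρ̄_v has
Serre weights in [2, p−5]; the census covers the rest. Negatives index (1 entry,
K3KugaSatakeDescent.SerreTypeAnchor) is unrelated; the typed slices bind p prime, 7 ≤ p, and pin RD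
exactly as the audited TriangulineChamber slices.
RANKED CRUXES. After the split (6 cruxes + 1 target; informal cruxes were filed by `workitem add
--informal`, no honest one-line Prop yet — see NOT DECOMPOSED YET): #2 TrivialFieldReachabilityR
(stmt-Langlands-13883; repaired 14504; THE HEART) — for K = ℚ_{p^f} (any f), λ regular unbounded,
ANY ρ̄ and any NON-ORDINARY point x of X_λ(ρ̄): over every ADMISSIBLE L′ ⊇ L₀ = K^{ker ρ̄}(ζ_p,
(−p)^{1/(p^f−1)})·K₂ (admissible = X_{λ_{L′}}(𝟙) has a non-ordinary trivial-reduction diagonal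
point; automatic for e_{L′} ≥ 2(p^f−1)) the component of X_{λ_{L′}}(𝟙) through ρ_x|G_{L′} contains a
non-ordinary diagonal point; covers every non-ordinary point — shadow or λ-seeded, reducible or
irreducible ρ̄ — and implies PD2Unram for every f (why it might fail: nothing controls
π₀(X_{λ_{L′}}(𝟙)) for e_{L′} ≥ 2(p^f−1), gaps ≥ p+1; an open-closed invariant finer than
cr-ordinarity may exist; sources GeeKisin2014 L.3.4.1, Kisin2009 Cor 2.5.16, BarnetlambEtAl2014 §1.4
p.13, arXiv:2607.08660). #3 ShadowPDWeightPplus2 (stmt-Langlands-14523) — every V_{p+2,a_p} (p ≥ 5)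
is PD; open part 0 < v(a_p) < 1 where V̄ = ind(ω₂²) is a shadow type (BuzzardGee2009 Thm 1.6, Rem
5.4), to be done by an explicit connected family over L = ℚ_{p²}((−p)^{2/(p²−1)}) to a diagonal
point; first run p = 5, k = 7 (why it might fail: the component of V|G_L may avoid every diagonal
point for every L tried — then V is the first explicit candidate non-PD crystalline representation).
#3b ReduciblePDWeight3p (stmt-Langlands-13994) — p ≥ 5, K = ℚ_p, k = 3p: every irreducible
crystalline V of weights {0, 3p−1} with V̄^ss ≅ ω²μ_α ⊕ μ_β is PD; such V exist (Breuil–Mézard: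
Sym^{3p−2} = 2σ_{1,0} + σ_{p−4,2} + 2σ_{p−2,1} for p = 5, 7, 11, 13, against an ordinary part of
multiplicity 1 — k = 3p is the first such weight), have no unramified seed, and are to be reached
over the TAME field ℚ_p(ζ_p) (degree p−1; C(p−1,(p−1)/2) non-ordinary trivial-reduction diagonal
types; p = 5: degree 4, dimension 8, 6 targets — the cheapest ramified computation of the route) for
split V̄, over the wild field ℚ_p^{ker ρ̄}(ζ_p) for non-split V̄ (why it might fail: as #2 — a
diagonal-free component makes V the first non-PD crystalline representation; sources
BarnetlambEtAl2014 §1.4, Geraghty2018, Kisin2009, arXiv:1209.5205, arXiv:1309.1658, GeeKisin2014,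
CarusoLubicz2013). Typed (full text, why-lines and sources in the docstrings): #0 LiftB2Unram
(TARGET; derived inside `closes` from #5 + #6) — the (B)-direction LIFTING slice for n = 2 over
totally real F at primes p ≥ 7 unramified in F, every regular weight, any residue degrees,
ρ̄|G_{F(ζ_p)} absolutely irreducible, ∃RD pinned by the cyclotomic HT weights and the conjoined
(A)₂; = PD2Unram + PD lifting (PDChain); implies TriangulineChamber.LiftB2CrysUnramifiedP; #5
LiftB2UnramSmallF (crux) — every v ∣ p has f_v ≤ 2, the CERTIFIED-CENSUS range (largely in print for
Serre weights in [2, p−5], arXiv:2512.04641 Thm 1.2); #6 LiftB2UnramLargeF (crux) — some f_v ≥ 3,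
beyond every printed all-weight lifting theorem (arXiv:2512.04641 Rem 1.1), inside #2's
f-independent claim; #9 SliceToLanglands (CRUX since 2026-08-16: a hypothesis of `closes`) — the
declared remainder LiftB2Unram → Langlands, i.e. the rest of GL_n reciprocity; rank 9, not the
line's bet, staffed after everything else. Supports: #7 PD2Unram (stmt-Langlands-14643) — the local
thesis X, implied by #2 + BarnetlambEtAl2014 Lemma 1.4.3(1) (ordinary points); PDChain
(stmt-Langlands-14681; keyword-badged `assembly` by the gate — operator re-badge to support still
wanted, it is in-print glue) — BLGGT §1.4 calculus, Gee–Kisin trivialisation, PD lifting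
BLGG-MathAnn Thm 3.1.2/A.4.1 + BLGG-MRL Thm 2.1.2 + BLGGT Thm 4.2.1, (A)₂ ⇒ Corresponds;
LiftB2UnramSplitP (stmt-Langlands-12044) — p split completely, in print (Kisin2009 + arXiv:1209.5205
+ arXiv:1309.1658), calibration anchor; ReciprocityDataInputs (stmt-Langlands-9501) — needs-fact
carrier (LocalLanglandsDatum.nonempty, PstWeilDeligneData.nonempty) shared with TriangulineChamber;
Assembly (stmt-Langlands-12046) — LiftB2UnramSmallF → LiftB2UnramLargeF → LiftB2Unram, pure logic,
candidate proof attached, optional since the crux-only `closes`. CARVED OUT to the sibling thesis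
WachSeedCensus (2026-08-16; listed as non-crux support here ONLY until the operator's drop, not this
route's claims any more): LambdaTypeSeedsIrred (stmt-Langlands-13889; evidence
BM_TABLES_EVIDENCE.md, seed_vs_toptype.py/.out, bm_e_table.py/.out, crux-attack SURVIVES) and
ReducibleNonOrdinaryReach (stmt-Langlands-13900). SETTLED DEBRIS awaiting the same operator drop
(nobody should claim or attack them): LambdaTypeSeeds (stmt-Langlands-14580, refuted-misstated p =
5, k = 15; repaired form = 13889; the gate re-badges it crux from the word 'Conjecture' in its text
— it is NOT a crux of this route), LambdaTypeSeedsR (stmt-Langlands-13901, duplicate of 13889),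
TrivialFieldReachability (stmt-Langlands-14504, refuted-misstated p = 7, λ = (0,11), L = ℚ_49(ζ_7);
repaired form = #2), the probe stmt-Langlands-13884; dropped earlier: SeedsOverQp2
(stmt-Langlands-12451, misstated). OPERATOR ACTION WANTED (fourth request; REPAIR-REQUEST.md on
13884, OPERATOR-REQUEST.md on 14681): re-badge 14681 support (or drop it — its text is ready to
re-file as support), then `route edit --drop` 13889 13900 14580 13901 13884 14504.
TWO-LAYER PLAN. Foreseen glued splits (nothing filed now): ShadowPDWeightPplus2 ⇐ (0 < v(a_p) < 1:
connected family over L) → (v(a_p) = 1: Bhattacharya–Ghate–Rozensztajn residues sorted into λ-seeded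
/ shadow) → glue with the in-print disc v(a_p) > 1; TrivialFieldReachabilityR ⇐ (f = 1, all k: the
method of #3 / #3b in every weight, over the first admissible field) → (f = 2) → general f;
ReduciblePDWeight3p ⇐ (split V̄, tame ℚ_p(ζ_p): p = 5 first) → (non-split V̄, wild field) → (all p ≥
5); PD2Unram ⇐ #2 + BarnetlambEtAl2014 Lemma 1.4.3(1) (ordinary points), any f; LiftB2UnramSmallF ⇐
(generic ρ̄_v: arXiv:2512.04641, support) → (non-generic ρ̄_v: PD2Unram + PDChain) → glue by case
split on Serre weights. Cross-route edges: LiftB2Unram proved ⇒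
TriangulineChamber.LiftB2CrysUnramifiedP (its rank-4 crux) by dropping a hypothesis; the sibling
WachSeedCensus, once opened, shares #5/#6/#9 and #2 restricted to the shadow + reducible sector.
KILL CRITERIA. ShadowPDWeightPplus2 refuted — a proof that V_{p+2,a_p} (some p ≥ 5, 0 < v(a_p) < 1)
connects to NO direct sum of crystalline characters over any finite extension, i.e. an explicit
non-PD crystalline representation — kills PD2Unram and both typed cruxes as PD-routes: close
`refuted:PD2Unram` with the computation as evidence (a negative answer to BLGGT's printed question,
valuable to every lifting route; the typed slices would survive only through other mechanisms, e.g.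
TriangulineChamber). ReduciblePDWeight3p refuted (an irreducible weight-3p lift of ω²μ_α ⊕ μ_β
connecting to no diagonal point over any L′) kills PD2Unram in the same way.
TrivialFieldReachabilityR refuted at some admissible level ⇒ the refutation names an open-closed
invariant ι finer than cr-ordinarity: if diagonal points realise every value of ι at a larger
admissible level, ONE more restatement (ι-matching diagonal points), else the refuting x is non-PD ⇒
close `refuted:PD2Unram`; evidence over an INADMISSIBLE field (all its trivial-reduction diagonal
points ordinary) refutes nothing — that is the settled negative of stmt-Langlands-14504/14580 as
filed. A refutation CONFINED to the irreducible λ-seeded sector over K₂ (a seed-free component over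
the unramified quadratic field) is the sibling WachSeedCensus's kill, not this route's: #2 works
over ramified admissible fields. A typed slice refuted would contradict Fontaine–Mazur (not
expected); a slice found junk-witnessable or vacuous ⇒ restate, not close. LiftB2UnramSmallF proved
elsewhere (perfectoid classicality for non-generic ρ̄_v) ⇒ it becomes support, staffing moves to
LiftB2UnramLargeF; LiftB2Unram proved elsewhere (classicality for all ℚ_{p^f}) ⇒ close `superseded`,
re-filing PD2Unram / TrivialFieldReachabilityR under a structure route (PD keeps independent value:
change of weight, potential automorphy, compatible systems).
NOT DECOMPOSED YET. The informal heart — TrivialFieldReachabilityR (#2), ShadowPDWeightPplus2 (#3),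
ReduciblePDWeight3p (#3b), PD2Unram (#7) — and the in-print glue PDChain are informal: potential
diagonalisability IS typed (Literature …PotentialDiagonalizability, relative to
CrystallineExtensionData = B_cris data along K'/K; the bridge Literature
…PstCrystallineExtensionData requested as D1 has LANDED per grounder g18-7 / the 13994 crux-attack
note, so typing #7 and then #2/#3/#3b over the summit's own datum is now the first tenure task; a
components notion for X_λ(ρ̄) is still missing for #2's signature). SIBLING THESIS (carved out
2026-08-16, NOT a part of this route any more; to be opened as route WachSeedCensus from card
wach-module-component-census when route opening resumes): X_B = 'for IRREDUCIBLE λ-seeded ρ̄ over K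
∈ {ℚ_p, ℚ_{p²}} every component of X_λ(ρ̄), base-changed to the unramified quadratic K₂, meets the
(non-ordinary, mixed-type) seed locus' (LambdaTypeSeedsIrred, stmt-Langlands-13889 text, rank 2
there; first cases p = 5, k = 11, ρ̄ = ind(ω₂^{10}), e = 3; children FiniteDeterminationF2 =
explicit f = 2 constancy radius + #π₀ ≤ e(R^λ(ρ̄)/ϖ), CensusTableF2 = certified kit table p ∈ {5,
7}, k_τ ≤ p² + 1) ∧ ReducibleNonOrdinaryReach (stmt-Langlands-13900 text, rank 3 there) ∧ this
route's #2 restricted to the shadow sector ⇒ PD2Unram ⇒ the shared typed slices #5/#6 ⇒ #9 ⇒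
Langlands. Deliberately NOT decomposed here: the v(a_p) = 1 circle of #3, the Breuil–Kisin census
over the trivialising field beyond the first two weights, n ≥ 3, ramified K
(TriangulineChamber.LiftB2CrysRamifiedP's sector), irregular weights, p ∈ {2, 3, 5} globally,
extension-class obstructions for non-split ρ̄ (inside #2), and the ReciprocityData transport lemmas
shared with LiftDescend / TriangulineChamber.
CHEAPEST FALSIFIER. (1) Literature, minutes: a printed proof that every V_{k,a_p} (K = ℚ_p, all k)
is PD, or a printed non-PD crystalline example, settles #3 / the line at once. Run here:
BarnetlambEtAl2014 §1.4 READ (p. 14: "As far as we know they could all be"), GeeKisin2014 Lemma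
3.4.1 READ (p. 15, the only printed trivialising-field argument, BT weight, 'extending L if
necessary'), arXiv:1109.4226 grep, arXiv:1908.07185 Thm 1.2.2 READ (PD lifts in SOME weight — not
decisive), BartlettLeHungLevin2026 abstract, BuzzardGee2009 Thm 1.6 + Rem 5.4 READ, galaxy
"potentially diagonalizable" --star all (5 hits, none decides): V_{p+2,a_p}, 0 < v(a_p) < 1, is
PD-undecided in print. (2) Computation, days–weeks (kit; sage/PARI + a Breuil–Kisin reduction
routine over L = ℚ_25(ϖ), ϖ^{12} = −5 — an ADMISSIBLE field, non-ordinary δ_S with n₀ + n₁ ≡ 0 mod 4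
exist; per the 14523 attack note the census may start over the tame ℚ_5((−5)^{1/6}), degree 6, fibre
dimension 10, where ρ̄-compatible diagonal points already exist — that proves #3, not #2): p = 5, k
= 7, a_5 = 5^{1/2}: search for an arc of weakly admissible filtered φ-modules over L (one φ over
ℚ_25, one Hodge line per embedding) from V_{7,a_5}|G_L to a NON-ordinary diagonal δ_S (n₀ + n₁ ≡ 0
mod 4, 0 < n_i < 12) along which some lattice keeps trivial reduction; success proves #3 for p = 5
(with Kisin2007 3.3.8), systematic failure across arcs and across two enlargements of L is the
evidence that would retire the line. Not run here (planner seat; no kit in this unit). (3) Cheaper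
still, #3b: p = 5, k = 15, V̄ = ω² ⊕ 1 split, L′ = ℚ_5(ζ_5) — degree 4, dim X_{λ_{L′}}(𝟙) = 8, six
non-ordinary δ_S (|S| = 2) — Breuil–Kisin algebra with E(u) of degree 4. (The unramified f ≤ 2
census computation p = 5, k = 11, ρ̄ = ind(ω₂^{10}) belongs to the sibling WachSeedCensus.)
NUMBERS. dim Spec R^{□,cris,λ}(ρ̄)[1/p] = 4 + [K:ℚ_p] for n = 2, λ regular (Kisin2007 Thm 3.3.8: n²
+ Σ_τ dim GL₂/B), formally smooth. PD known: see WHY THIS LINE (ordinary; gaps ≤ p−1; n = 2 weights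
in [0, p]; pot-BT; n = 3 minimal weight; a PD lift in SOME weight). f = 1 constancy radius: v(a_p −
a_p') > 2v(a_p) + α(k−1), α(k−1) = Σ_{n≥1} ⌊(k−1)/(p^{n−1}(p−1))⌋ (Berger2011 Thm A; mod p^m:
arXiv:2005.01212 Thm 1.1); X(k, ρ̄) ⊆ D(0,1)⁺ a standard subset, #components ≤ c_E ≤ e(R(k,ρ̄)/π_E),
finitely determined (Rozensztajn2020 Thms 1–3). All-weight reduction constraint: ρ̄^ss|I ≅ τ(λ, w)
with λ ↑ μ (arXiv:2607.08660 Thm 1.2 / 5.5.6, §5.6 for unramified K) — a finite list of residual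
inertial types per weight, the census ledger. Census size ≈ p^{3f} parameter fibres per weight (p =
5, f = 2: 15 625). Typed slices: 7 ≤ p (l ≥ 7 ⇒ irreducible ⇒ adequate,
BarnetlambGeeGeraghty2013MathAnn App. A; BLGGT l ≥ 2(n+1)). Matsumoto's range: p ≥ 5, F_v ∈ {ℚ_p,
ℚ_{p²}} for all v ∣ p, Serre weights 2 ≤ k_{τ,1} − k_{τ,2} ≤ p − 5 (arXiv:2512.04641 Thm 1.2, 1.5).
Dichotomy bookkeeping: reducible crystalline lifts of weight λ have ρ̄^ss|I = ω_f^{−E_S} ⊕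
ω_f^{−E_{S^c}}, E_S = Σ_{τ∈S}(k_τ−1)p^{i(τ)} (2^f patterns), induced ones the ω_{2f} analogue;
worked shadow example p = 5, k = 8, ρ̄ = ind(ω₂³): seeds over ℚ_25 need 7e_S ≡ 3 mod 24 with e_S ∈
{0,1,5,6} (none), over ℚ_625 need e_S ≡ 546 mod 624 > 156 = max (none). First shadow weight k = p+2:
V̄_{p+2,a_p} = ind(ω₂²) for 0 < v(a_p) < 1 (BuzzardGee2009), = V̄_{p+2,0} for v(a_p) > 1
(Berger2011). Trivialising field for it: L = ℚ_{p²}(ϖ)·unr, ϖ^{(p²−1)/2} = −p, [L:ℚ_p] ≥ p²−1 (24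
for p = 5), dim X_{λ_L}(trivial) = 4 + [L:ℚ_p] (28); diagonal points δ_S indexed by embedding
subsets with n₀ + n₁ ≡ 0 mod 4 (p = 5). Items after the 2026-08-16 split: load-bearing 7 typed
(12041 target, 12042/12043/12045 crux, 12044/9501 support, 12046 assembly) + 5 informal
(13883/13994/14523 crux, 14643 support, 14681 glue) = 12 ≤ 15, plus 6 parked non-crux entries
(13889, 13900 → sibling; 14580, 13901, 13884, 14504 debris) until the operator drop; cruxes of the
thesis 6 ≤ 7 (ranks 2, 3, 3, 5, 6, 9; 7 while the gate keeps re-badging 14580). ADMISSIBILITY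
(route-repair): L′ ⊇ L₀ is admissible iff X_{λ_{L′}}(𝟙) has a non-ordinary trivial-reduction
diagonal point, i.e. some (n_τ′) ∈ [0, e_{L′}]^{f_{L′}}, not ≡ 0, not ≡ e_{L′}, with (p^{f_{L′}} −
1) ∣ Σ n_τ′ c_{τ′|K} p^{i(τ′)}; always when e_{L′} ≥ 2(p^f − 1) (n ≡ p^f − 1), e.g. L₀(√π); for f =
1, e_{L₀} = p − 1 (niveau-1 ρ̄, e.g. ω^a ⊕ ω^b) iff gcd(k − 1, p^{f_{L₀}} − 1) > 1 — the 14504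
witness p = 7, k = 12, L₀ = ℚ_49(ζ_7): gcd(11, 48) = 1, only (0,0), (6,6), inadmissible. DEFINITION
REQUESTS. D1 (FILED: defn-PstCrystallineExtensionData, --for stmt-Langlands-14643 PD2Unram):
`PstCrystallineExtensionData` — for a p-adic field K with datum 𝔇 : PstWeilDeligneData K p, a
COMPATIBLE family of crystalline period-ring data along the finite extensions K'/K inside K̄ (a
CrystallineExtensionData p K whose member at K' = ⊥ has the same admissible = crystalline
representations as 𝔇.IsCrystallineFramed and the same labelled Hodge–Tate weights as 𝔇.𝔅), as an
INTERFACE with the compatibility stated as predicates; with it PD2Unram and the PD lifting fact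
PDChain get one-line signatures over the summit's own datum (`∀ F p RD v …,
IsPotentiallyDiagonalizable (𝔅_of (RD.pst p v hv)) (ρ.toLocal v) → …`). Cite facts wanted later
(informal now): BLGGT §1.4 ∼-calculus over `ConnectsOver` (restriction, transitivity via Kisin2007
Thm 3.3.8; the cr-ordinary locus is a union of components, p.13); BarnetlambGeeGeraghty2013MathAnn
Thm A.4.1; Rozensztajn2020 Thm 1 second half.

Novelty: Searches (2026-08-15; `lit search` / searchd was unavailable, rc 75, three attempts logged in
NOTES.md — galaxy and direct reads used
instead): `lit galaxy search "potentially diagonalizable" --star all` (5: Emerton–Gee stacks book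
panama:484996296998942 → in-book hit =
Thm 1.2.2, READ chars 16500–21500; Tilouine–Raghuram volume; Dieulefait–Heath-Brown volume; Le–Le
Hung–Levin–Morra ×2); `lit galaxy
search "Wach module" --star all` (16: Zhu arXiv:0807.1078 and Dousmanis arXiv:0805.1634 relevant,
rest Euler systems); `lit galaxy
search "reductions of two-dimensional crystalline representations" --star all` (0); `lit read` with
grep of arXiv:1010.2561 (§1.4 pp.
4, 14, 25 READ), arXiv:1205.4491 (Thm 2.1.2 READ pp. 3–5), arXiv:1106.5586 (Thm 3.1.2 p. 12, Thm
A.4.1 pp. 25–26 READ), arXiv:1109.4226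
(p. 24 READ), arXiv:2512.04641 (pp. 1–5 READ: Thm 1.2, 1.4, 1.5, Rem 1.1, 1.3, 1.6),
arXiv:2607.08660 (pp. 1–5 READ: Thm 1.2, Props
1.3–1.5, contents §5.6), arXiv:2005.01212 (Thms 1.1–1.2 READ: G_{ℚ_p} only); `ledger negatives
--problem Langlands` (1, unrelated);
the card's and the retired route's searches (zbMATH ×12, 108 cards) and the refuter audit PASS 7
(2026-08-15T18:06Z, kept
new-combination) inherited.
Nearest prior art found: arXiv:2512.04641 (Matsumoto 2025: all-weight lifting + Breuil–Mézard for
GL₂(ℚ_{p²}), generic Serre weights,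
all v ∣ p of degree ≤ 2 — the nearest on the PAYOFF side, found after the card was written);
BartlettLeHungLevin2026 (arXiv:2604.17466)
/ Bartlett20  [refs: 0807.1078, 0805.1634, 1010.2561, 1205.4491, 1106.5586, 1109.4226, 2512.04641, 2607.08660, 2005.01212, 2604.17466, 1908.07185, BartlettLeHungLevin2026, Bartlett2020, GaoLiu2014, Rozensztajn2020, Rozensztajn2018, Dousmanis2010, Guzman2024]

Barriers (technique_class: wach-modules breuil-kisin pd-census automorphy-lifting): - technique_class: wach-modules breuil-kisin pd-census automorphy-lifting
- Literature.Barriers.Langlands.PatchingLocalComponentBarrier: ATTACKED, not evaded — PD2Unram is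
exactly the printed escape clause ("r|G_{F_v} potentially diagonalisable") made universal for GL₂
over unramified F_v; the census proves one-component-reachability instead of assuming it, and if a
seedless component exists the census finds it (kill criterion).
- Literature.Barriers.Langlands.ModPLanglandsGL2BeyondQpFpBar: evaded — no mod-p / p-adic local
Langlands for GL₂(F_v) is used; reductions for f ≥ 2 are computed by Wach / Breuil–Kisin semilinear
algebra (Dousmanis2010, CarusoLubicz2013, Guzman2024), not by the LLC-based method of
Rozensztajn2018 (f = 1 only, where LLC exists).
- Literature.Barriers.Langlands.BreuilPaskunas2012_supersingularFamily: evaded — the abundance of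
supersingular representations of GL₂(ℚ_{p^f}) is invisible on the Galois side, where the census
lives.
- Literature.Barriers.Langlands.ModPLanglandsGL2BeyondQp: (deprecated mis-stated form) same as the
FpBar entry.
- Literature.Barriers.Langlands.TaylorWilesNumericalCoincidence: not engaged — GL₂ over totally real
F is the defect-zero setting the imported lifting theorems already handle (via solvable base change
to CM and back); nothing is claimed in positive defect.
- Literature.Barriers.Langlands.TaylorWilesNumericalCoincidenceNarrow: not engaged, same.
- Literature.Barriers.Langlands.ResiduallyReducibleBarrier: not engaged — ρ̄|

History (route lifecycle, newest last):
- 2026-08-15T19:02:02Z · rev 1: dropped stmt-Langlands-12451 — planner self-correction minutes after filing: SeedsOverQp2 as worded claims unramified seeds for EVERY residual rho-bar, but for rho-bar of shadow type (rho-bar (planner-plancard-Langlands-Langlands-wach-mod-681c8d54-g2-0)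
- 2026-08-16T02:19:05Z · AUTO-CRUX: 1 conjecture-grade item(s) promoted to crux (LambdaTypeSeeds) — refuter vetting / tiering apply (operator:999:1362873)
- 2026-08-16T04:10:27Z · AUTO-CRUX (backfill): LiftB2Unram — hypotheses of the deciding theorem that nothing in the route derives are cruxes (operator:999:1085951)
- 2026-08-16T14:43:07Z · LINT AUTOFIX route.multi-assembly: kept Assembly, dropped Assembly2 (gate:hygiene)
- 2026-08-17T05:07:50Z · rev 24: dropped ReciprocityDataInputs, stmt-Langlands-13884, stmt-Langlands-13901, stmt-Langlands-14504, stmt-Langlands-14580 — route-repair 5a1bd9af (statement-revised p141787): closes re-certified unchanged (crux-only hS hL hJ → Langlands; the new conjunct Nonempty (ReciprocityData F) (planner-rrepair-Langlands-WachComponentCensus--5a1bd9af-0)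
- 2026-08-17T05:18:13Z · rev 27: restated CanonicalReciprocityData (stmt-Langlands-17924) — restate stmt-Langlands-17924 CanonicalReciprocityData (support): same proposition, fully-qualified Summit.Langlands.ReciprocityData, informal reworded without t (planner-rrepair-Langlands-WachComponentCensus--5a1bd9af-0)
- 2026-08-24T17:01:59Z · DORMANT — reconciler: no traction for 6.9 d (last activity statement-attached at 2026-08-17T18:27:31Z); parked, not closed — `ledger route dormant route-Langlands-WachCom (operator:999:1737240)
- 2026-08-29T15:24:33Z · REACTIVATED — reconciler: reactivated — activity statement-checked at 2026-08-29T13:35:58Z after parking at 2026-08-24T17:01:59Z (operator:999:1585189)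

sub-problem: Langlands · status: open · opened planner-plancard-Langlands-Langlands-wach-mod-681c8d54-g2-0 2026-08-15T18:48:02Z · rev 27 · ledger route-Langlands-WachComponentCensus
GENERATED by the gate from the ledger (D-0016/17). Provers cite these decls: `theorem foo : Summit.Langlands.Langlands.Theses.WachComponentCensus.<Decl> := …` in Summits/Langlands/Langlands/Theorems/<Name>.lean.
-/

namespace Summit.Langlands.Langlands.Theses.WachComponentCensus

open scoped BigOperators Topology Manifold Classical MeasureTheory ProbabilityTheory Matrix InnerProductSpace ComplexConjugate ContinuousMap
open Filter Set Function TopologicalSpace MeasureTheory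

attribute [summit_statement] _root_.Langlands

/-- item stmt-Langlands-12041 · target (kind.auto-crux: conjecture-grade) · rank 0 · open · by planner
why it might fail: Some component of X_λ(ρ̄_v), K = ℚ_{p^f} unramified, k_τ ≥ p+2, may carry no PD point (BLGGT §1.4; PD known only in complete-flag, FL, [0,p], pot-BT cases: arXiv:2604.17466 §1); printed all-weight lifting needs generic ρ̄_v with all f_v ≤ 2 (arXiv:2512.04641) or parallel weight (arXiv:2605.18426).
sources: BarnetlambEtAl2014, arXiv:2604.17466, CalegariEmertonGee2020, arXiv:2512.04641, arXiv:2605.18426, BarnetlambGeeGeraghty2013MathAnn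
[target] (B)-direction LIFTING slice for n = 2 over totally real F at primes p ≥ 7 unramified in F:
there are reciprocity data RD — pinned by HT_τ(ε^m) = {−m} at every v ∣ p and every ℚ_p-embedding τ,
and by the conjoined known (A)-direction for regular L-algebraic cuspidal π of GL₂/F — such that
every irreducible, geometric, totally odd ρ : G_F → GL₂(ℚ̄_p), crystalline at every v ∣ p
(RD.pst-relative: de Rham, WD unramified, N = 0) with multiplicity-free τ-labelled HT weights of
cardinality 2 for every τ (ANY weight, ANY residue degrees), with ρ̄|G_{F(ζ_p)} absolutely
irreducible and ρ̄ ≡ ρ₀ for the ρ₀ of a regular L-algebraic cuspidal π₀, corresponds (Corresponds RD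
ι π ρ) to an L-algebraic cuspidal π. = PD2Unram + PD lifting (PDChain); no genericity hypothesis, so
it implies TriangulineChamber.LiftB2CrysUnramifiedP. -/
@[route_item "route-Langlands-WachComponentCensus", crux]
def LiftB2Unram : Prop :=
  ∀ (F : Type) [Field F] [NumberField F] [NumberField.IsTotallyReal F] (p : ℕ) [Fact p.Prime], 7 ≤ p → ¬ ((p : ℤ) ∣ NumberField.discr F) → ∃ RD : ReciprocityData F, (∀ (m : ℤ) (χ : Literature.NumberTheory.GaloisRepresentations.FramedGaloisRep F (PadicAlgCl p) 1), (∀ σ, (χ σ).val 0 0 = algebraMap ℚ_[p] (PadicAlgCl p) ((((Literature.NumberTheory.GaloisRepresentations.GaloisRep.cyclotomicCharacter F p σ : ℤ_[p]ˣ) : ℤ_[p]) : ℚ_[p]) ^ m)) → ∀ (v : IsDedekindDomain.HeightOneSpectrum (NumberField.RingOfIntegers F)) (hv : ((p : ℕ) : NumberField.RingOfIntegers F) ∈ v.asIdeal), let D := RD.pst p v hv; letI := D.algebra; ∀ τ : v.adicCompletion F →ₐ[ℚ_[p]] PadicAlgCl p, χ.labelledHodgeTateWeightsAt v D.algebra D.𝔅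 τ.toRingHom = {-m}) ∧ ∀ hcpt : Literature.NumberTheory.Automorphic.isCompact_glFiniteIntegralLevel 2 F, (∀ π : Literature.NumberTheory.Automorphic.CuspidalAutomorphicRepData 2 F hcpt, π.1.IsLAlgebraic → (∃ T : Literature.NumberTheory.Automorphic.InfinityType F 2, π.1.HasInfinityType T ∧ T.IsRegular) → ∀ (ℓ : ℕ) [Fact ℓ.Prime] (ι : PadicAlgCl ℓ ≃+* ℂ), ∃ ρ : Literature.NumberTheory.GaloisRepresentations.FramedGaloisRep F (PadicAlgCl ℓ) 2, ρ.toGaloisRep.IsIrreducible ∧ IsGeometricFramed RD ρ ∧ Corresponds RD ι π.1 ρ) ∧ (∀ (ι : PadicAlgCl p ≃+* ℂ) (ρ : Literature.NumberTheory.GaloisRepresentations.FramedGaloisRep F (PadicAlgCl p) 2), ρ.toGaloisRep.IsIrreducible → IsGeometricFramed RD ρ → ρ.IsOdd → (∀ (v : IsDedekindDomain.HeightOneSpectrum (NumberField.RingOfIntegers F)) (hv : ((p : ℕ) : NumberField.RingOfIntegers F) ∈ v.asIdeal), let D := RD.pst p v hv; D.IsCrystallineFramed (ρ.toLocal v) ∧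 (letI := D.algebra; ∀ τ : v.adicCompletion F →ₐ[ℚ_[p]] PadicAlgCl p, let M := ρ.labelledHodgeTateWeightsAt v D.algebra D.𝔅 τ.toRingHom; M.Nodup ∧ Multiset.card M = 2)) → (¬ ∃ χ₁ χ₂ : Field.absoluteGaloisGroup (CyclotomicField p F) →* (PadicAlgCl p)ˣ, IsOpen (χ₁.ker : Set (Field.absoluteGaloisGroup (CyclotomicField p F))) ∧ IsOpen (χ₂.ker : Set (Field.absoluteGaloisGroup (CyclotomicField p F))) ∧ ∀ σ, ‖(ρ.restrictField (CyclotomicField p F) σ).val.trace - ((χ₁ σ : PadicAlgCl p) + (χ₂ σ : PadicAlgCl p))‖ < 1) → (∃ (π₀ : Literature.NumberTheory.Automorphic.CuspidalAutomorphicRepData 2 F hcpt) (ρ₀ : Literature.NumberTheory.GaloisRepresentations.FramedGaloisRep F (PadicAlgCl p) 2), π₀.1.IsLAlgebraic ∧ (∃ T : Literature.NumberTheory.Automorphic.InfinityType F 2, π₀.1.HasInfinityType T ∧ T.IsRegular) ∧ Corresponds RD ι π₀.1 ρ₀ ∧ ∀ σ, ‖(ρ σ).val.trace - (ρ₀ σ).val.trace‖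 < 1) → ∃ π : Literature.NumberTheory.Automorphic.CuspidalAutomorphicRepData 2 F hcpt, π.1.IsLAlgebraic ∧ Corresponds RD ι π.1 ρ)

-- item stmt-Langlands-13883 · crux · rank 2 · open · by planner — informal only, no Lean statement yet:
--   [crux] (rank 2; the heart; REPAIRED TrivialFieldReachability = stmt-Langlands-14504,
--   refuted-misstated: the PINNED field L(ρ̄,λ) can be too small — p=7, λ=(0,11), ρ̄=ω⁴⊕ω, L=ℚ_49(ζ_7):
--   all trivial-reduction diagonal points over L are cr-ordinary, ρ_x|G_L never is, the cr-ordinary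
--   locus is open-closed (REFUTATION.md there); repair = GeeKisin2014 L.3.4.1's clause 'Extending L if
--   necessary … a decomposable NON-ordinary crystalline lift'; scope widened to every non-ordinary
--   point, absorbing the sector lost by LambdaTypeSeeds, stmt-Langlands-14580.) NON-ORDINARY
--   REACHABILITY OVER ADMISSIBLE TRIVIAL

-- item stmt-Langlands-13994 · crux · rank 3 · open · by planner — informal only, no Lean statement yet:
--   [crux] (rank 3; first residually-REDUCIBLE non-ordinary instance — the component class exposed by
--   the refutation of LambdaTypeSeeds, stmt-Langlands-14580; parallel to ShadowPDWeightPplus2, the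
--   cheapest ramified computation of the route, a calibrated entry of the repaired #2 =
--   TrivialFieldReachabilityR) PD IN THE FIRST RESIDUALLY-REDUCIBLE NON-ORDINARY WEIGHT k = 3p. Let p ≥
--   5, K = ℚ_p, k = 3p, λ = (0, 3p−1) (ω^{3p−1} = ω²), X(3p, ρ̄) := Spec R^{□,cris,λ}(ρ̄)[1/p] ⊗ ℚ̄_p
--   for ρ̄ REDUCIBLE with ρ̄^ss ≅ ω²μ_α ⊕ μ_β (μ's unramified; split or non-split). FACTS: (i) the
--   cr-ordinary locus of X(3p, ρ̄)

-- item stmt-Langlands-14523 · crux · rank 3 · open · by planner — informal only, no Lean statement yet: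
--   [crux] (rank 3; first shadow instance; cheapest kill and first theorem beyond Bartlett2020's range
--   [0,p]) PD IN THE FIRST SUPER-p WEIGHT. Let p >= 5, k = p+2 (labelled weight (0, p+1): Hodge–Tate gap
--   p+1, the first beyond Bartlett2020 / GaoLiu2014), K = Q_p. CLAIM: every crystalline V_{p+2, a_p}
--   (Berger2011 §1 notation; a_p in m_E) is potentially diagonalisable (BarnetlambEtAl2014 §1.4). STATUS
--   BY SLOPE: (i) v(a_p) > 1 = floor((k-2)/(p-1)): Vbar = Vbar_{p+2,0} is constant on this disc
--   (BergerLiJunezhu2004; Berger2011 Thm A), the disc is connected and contains a_p = 0, where V_{p+2,0}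
--   is induce

/-- item stmt-Langlands-12042 · crux · rank 5 · open · by planner
why it might fail: Non-generic ρ̄_v over ℚ_{p²} (Serre-weight gap in {0,1} or ≥ p−4) is outside arXiv:2512.04641 Thm 1.2 cond. 6, non-parallel weights are outside arXiv:2605.18426, PD stops at HT gaps ≤ p (Bartlett2020, GaoLiu2014, arXiv:2604.17466); a diagonal-free component of X_λ(ρ̄_v) over every L blocks it.
sources: arXiv:2512.04641, arXiv:2605.18426, arXiv:2604.17466, CalegariEmertonGee2020, BarnetlambEtAl2014, BarnetlambGeeGeraghty2013MRL
[crux] the target slice restricted to F in which every place above p has residue degree f_v ≤ 2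
(residue field of size ≤ p²) — the CERTIFIED-CENSUS range: here Conjecture C is decided fibre by
fibre by exact Wach/Breuil–Kisin reductions for K ∈ {ℚ_p, ℚ_{p²}} (items SeedsOverQp2,
ComponentCensusF2 filed after open) and PD lifting gives the slice. Largely in print for ρ̄_v with
Serre weights in [2, p−5] (Matsumoto, arXiv:2512.04641 Thm 1.2, via perfectoid classicality, p ≥ 5);
the census adds the non-generic ρ̄_v and an independent PD proof. [difficulty: open-problem] -/
@[route_item "route-Langlands-WachComponentCensus", crux]
def LiftB2UnramSmallF : Prop :=
  ∀ (F : Type) [Field F] [NumberField F] [NumberField.IsTotallyReal F] (p : ℕ) [Fact p.Prime], 7 ≤ p → ¬ ((p : ℤ) ∣ NumberField.discr F) → (∀ v : IsDedekindDomain.HeightOneSpectrum (NumberField.RingOfIntegers F), ((p : ℕ) : NumberField.RingOfIntegers F) ∈ v.asIdeal → v.residueCard ≤ p ^ 2) → ∃ RD : ReciprocityData F, (∀ (m : ℤ) (χ : Literature.NumberTheory.GaloisRepresentations.FramedGaloisRep F (PadicAlgCl p) 1), (∀ σ, (χ σ).val 0 0 = algebraMap ℚ_[p] (PadicAlgCl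 p) ((((Literature.NumberTheory.GaloisRepresentations.GaloisRep.cyclotomicCharacter F p σ : ℤ_[p]ˣ) : ℤ_[p]) : ℚ_[p]) ^ m)) → ∀ (v : IsDedekindDomain.HeightOneSpectrum (NumberField.RingOfIntegers F)) (hv : ((p : ℕ) : NumberField.RingOfIntegers F) ∈ v.asIdeal), let D := RD.pst p v hv; letI := D.algebra; ∀ τ : v.adicCompletion F →ₐ[ℚ_[p]] PadicAlgCl p, χ.labelledHodgeTateWeightsAt v D.algebra D.𝔅 τ.toRingHom = {-m}) ∧ ∀ hcpt : Literature.NumberTheory.Automorphic.isCompact_glFiniteIntegralLevel 2 F, (∀ π : Literature.NumberTheory.Automorphic.CuspidalAutomorphicRepData 2 F hcpt, π.1.IsLAlgebraic → (∃ T : Literature.NumberTheory.Automorphic.InfinityType F 2, π.1.HasInfinityType T ∧ T.IsRegular) → ∀ (ℓ : ℕ) [Fact ℓ.Prime] (ι : PadicAlgCl ℓ ≃+* ℂ), ∃ ρ : Literature.NumberTheory.GaloisRepresentations.FramedGaloisRep F (PadicAlgCl ℓ) 2, ρ.toGaloisRep.IsIrreducible ∧ IsGeometricFramed RD ρ ∧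 Corresponds RD ι π.1 ρ) ∧ (∀ (ι : PadicAlgCl p ≃+* ℂ) (ρ : Literature.NumberTheory.GaloisRepresentations.FramedGaloisRep F (PadicAlgCl p) 2), ρ.toGaloisRep.IsIrreducible → IsGeometricFramed RD ρ → ρ.IsOdd → (∀ (v : IsDedekindDomain.HeightOneSpectrum (NumberField.RingOfIntegers F)) (hv : ((p : ℕ) : NumberField.RingOfIntegers F) ∈ v.asIdeal), let D := RD.pst p v hv; D.IsCrystallineFramed (ρ.toLocal v) ∧ (letI := D.algebra; ∀ τ : v.adicCompletion F →ₐ[ℚ_[p]] PadicAlgCl p, let M := ρ.labelledHodgeTateWeightsAt v D.algebra D.𝔅 τ.toRingHom; M.Nodup ∧ Multiset.card M = 2)) → (¬ ∃ χ₁ χ₂ : Field.absoluteGaloisGroup (CyclotomicField p F) →* (PadicAlgCl p)ˣ, IsOpen (χ₁.ker : Set (Field.absoluteGaloisGroup (CyclotomicField p F))) ∧ IsOpen (χ₂.ker : Set (Field.absoluteGaloisGroup (CyclotomicField p F))) ∧ ∀ σ, ‖(ρ.restrictField (CyclotomicField p F) σ).val.trace - ((χ₁ σ : PadicAlgCl p)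 + (χ₂ σ : PadicAlgCl p))‖ < 1) → (∃ (π₀ : Literature.NumberTheory.Automorphic.CuspidalAutomorphicRepData 2 F hcpt) (ρ₀ : Literature.NumberTheory.GaloisRepresentations.FramedGaloisRep F (PadicAlgCl p) 2), π₀.1.IsLAlgebraic ∧ (∃ T : Literature.NumberTheory.Automorphic.InfinityType F 2, π₀.1.HasInfinityType T ∧ T.IsRegular) ∧ Corresponds RD ι π₀.1 ρ₀ ∧ ∀ σ, ‖(ρ σ).val.trace - (ρ₀ σ).val.trace‖ < 1) → ∃ π : Literature.NumberTheory.Automorphic.CuspidalAutomorphicRepData 2 F hcpt, π.1.IsLAlgebraic ∧ Corresponds RD ι π.1 ρ)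

/-- item stmt-Langlands-12043 · crux · rank 6 · open · by planner
why it might fail: f_v ≥ 3: classicality lifting is printed only for [F_v:ℚ_p] ≤ 2 (arXiv:2512.04641 Rem 1.1) or parallel weight (arXiv:2605.18426), both for generic ρ̄_v; PD unknown past HT gaps ≤ p (GaoLiu2014, Bartlett2020, arXiv:2604.17466); X_λ(ρ̄_v), dim 4+f, may have components no explicit Wach family meets.
sources: arXiv:2512.04641, arXiv:2605.18426, arXiv:2604.17466, GaoLiu2014, Bartlett2020, Dousmanis2010
[crux] the target slice when SOME place above p has residue degree f_v ≥ 3 (residue field larger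
than p²) — beyond the certified-census range and beyond every printed all-weight lifting theorem
(arXiv:2512.04641 Rem 1.1 uses [F_v:ℚ_p] ≤ 2 crucially); rests on PD2Unram for all unramified f, to
be reached from the component pattern found for f ≤ 2 (component types = ordinary /
split-after-unramified-quadratic-base-change) and proved by Dousmanis/Guzman/Zhu-type families,
which exist for every f. [deps: LiftB2UnramSmallF] [difficulty: open-problem] -/
@[route_item "route-Langlands-WachComponentCensus", crux]
def LiftB2UnramLargeF : Prop :=
  ∀ (F : Type) [Field F] [NumberField F] [NumberField.IsTotallyReal F] (p : ℕ) [Fact p.Prime], 7 ≤ p → ¬ ((p : ℤ) ∣ NumberField.discr F) → (∃ v : IsDedekindDomain.HeightOneSpectrum (NumberField.RingOfIntegers F), ((p : ℕ) : NumberField.RingOfIntegers F) ∈ v.asIdeal ∧ p ^ 2 < v.residueCard) → ∃ RD : ReciprocityData F, (∀ (m : ℤ) (χ : Literature.NumberTheory.GaloisRepresentations.FramedGaloisRep F (PadicAlgCl p) 1), (∀ σ, (χ σ).val 0 0 = algebraMap ℚ_[p] (PadicAlgCl p) ((((Literature.NumberTheory.GaloisRepresentations.GaloisRep.cyclotomicCharacter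 F p σ : ℤ_[p]ˣ) : ℤ_[p]) : ℚ_[p]) ^ m)) → ∀ (v : IsDedekindDomain.HeightOneSpectrum (NumberField.RingOfIntegers F)) (hv : ((p : ℕ) : NumberField.RingOfIntegers F) ∈ v.asIdeal), let D := RD.pst p v hv; letI := D.algebra; ∀ τ : v.adicCompletion F →ₐ[ℚ_[p]] PadicAlgCl p, χ.labelledHodgeTateWeightsAt v D.algebra D.𝔅 τ.toRingHom = {-m}) ∧ ∀ hcpt : Literature.NumberTheory.Automorphic.isCompact_glFiniteIntegralLevel 2 F, (∀ π : Literature.NumberTheory.Automorphic.CuspidalAutomorphicRepData 2 F hcpt, π.1.IsLAlgebraic → (∃ T : Literature.NumberTheory.Automorphic.InfinityType F 2, π.1.HasInfinityType T ∧ T.IsRegular) → ∀ (ℓ : ℕ) [Fact ℓ.Prime] (ι : PadicAlgCl ℓ ≃+* ℂ), ∃ ρ : Literature.NumberTheory.GaloisRepresentations.FramedGaloisRep F (PadicAlgCl ℓ) 2, ρ.toGaloisRep.IsIrreducible ∧ IsGeometricFramed RD ρ ∧ Corresponds RD ι π.1 ρ) ∧ (∀ (ι : PadicAlgCl p ≃+*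 ℂ) (ρ : Literature.NumberTheory.GaloisRepresentations.FramedGaloisRep F (PadicAlgCl p) 2), ρ.toGaloisRep.IsIrreducible → IsGeometricFramed RD ρ → ρ.IsOdd → (∀ (v : IsDedekindDomain.HeightOneSpectrum (NumberField.RingOfIntegers F)) (hv : ((p : ℕ) : NumberField.RingOfIntegers F) ∈ v.asIdeal), let D := RD.pst p v hv; D.IsCrystallineFramed (ρ.toLocal v) ∧ (letI := D.algebra; ∀ τ : v.adicCompletion F →ₐ[ℚ_[p]] PadicAlgCl p, let M := ρ.labelledHodgeTateWeightsAt v D.algebra D.𝔅 τ.toRingHom; M.Nodup ∧ Multiset.card M = 2)) → (¬ ∃ χ₁ χ₂ : Field.absoluteGaloisGroup (CyclotomicField p F) →* (PadicAlgCl p)ˣ, IsOpen (χ₁.ker : Set (Field.absoluteGaloisGroup (CyclotomicField p F))) ∧ IsOpen (χ₂.ker : Set (Field.absoluteGaloisGroup (CyclotomicField p F))) ∧ ∀ σ, ‖(ρ.restrictField (CyclotomicField p F) σ).val.trace - ((χ₁ σ : PadicAlgCl p) + (χ₂ σ : PadicAlgCl p))‖ < 1) → (∃ (π₀ : Literature.NumberTheory.Automorphic.CuspidalAutomorphicRepData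 2 F hcpt) (ρ₀ : Literature.NumberTheory.GaloisRepresentations.FramedGaloisRep F (PadicAlgCl p) 2), π₀.1.IsLAlgebraic ∧ (∃ T : Literature.NumberTheory.Automorphic.InfinityType F 2, π₀.1.HasInfinityType T ∧ T.IsRegular) ∧ Corresponds RD ι π₀.1 ρ₀ ∧ ∀ σ, ‖(ρ σ).val.trace - (ρ₀ σ).val.trace‖ < 1) → ∃ π : Literature.NumberTheory.Automorphic.CuspidalAutomorphicRepData 2 F hcpt, π.1.IsLAlgebraic ∧ Corresponds RD ι π.1 ρ)

/-- item stmt-Langlands-12045 · crux · rank 9 · open · by planner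
why it might fail: The REST of GL_n reciprocity beyond this slice (direction (A); all n and number fields; n ≠ 2; F not totally real; even, non-crystalline, residually small or non-automorphic ρ; p ∣ disc F; p < 7) is wide open (Fontaine–Mazur); the typed Langlands may be over-strong in corners (even ρ, irregular π).
sources: BuzzardGeeLMS2014, FontaineMazurGeometric1995, CalegariEmertonGee2020
[support] OUT-OF-SCOPE REMAINDER (D-0027 §2.1 layer invariant), filed only so that the route's glue
honestly ends at the summit: LiftB2Unram → Langlands. It contains everything this thesis does not
claim — direction (A) and the data 𝓡 for every number field, n ≠ 2, F not totally real, even /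
non-crystalline-at-p / residually small or residually non-automorphic ρ, p ramified in F, p < 7
(same pattern as TriangulineChamber.SliceToLanglands, CapacityClassicality.SectorToLanglands,
QuadraticWindow.BeyondTheWindow). Not to be staffed from this route. [difficulty: open-problem] -/
@[route_item "route-Langlands-WachComponentCensus", crux]
def SliceToLanglands : Prop :=
  LiftB2Unram → _root_.Langlands

-- item stmt-Langlands-13889 · support · rank 4 · open · by planner — informal only, no Lean statement yet:
--   [crux] (rank 4; REPAIRED LambdaTypeSeeds — stmt-Langlands-14580 was refuted-misstated 2026-08-15,
--   refuter's C′ = restrict to IRREDUCIBLE ρ̄; the unramified Wach-module census in the domain where it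
--   can hold) LAMBDA-TYPE SEEDS, IRREDUCIBLE CASE. Let p ≥ 5, K ∈ {Q_p, Q_{p²}}, λ = (0, k_τ−1)_τ
--   regular with k_τ UNBOUNDED, K₂/K the unramified quadratic extension, λ₂ = λ∘(restriction of
--   embeddings), X_λ(ρ̄) := Spec R^{□,cris,λ}(ρ̄)[1/p] ⊗ Q̄_p, and ρ̄ : G_K → GL₂(F̄_p) IRREDUCIBLE and
--   λ-SEEDED: X_{λ₂}(ρ̄|K₂) contains a direct sum of two crystalline characters or a lift with a
--   G_{K₂}-stable line (for

-- item stmt-Langlands-13900 · support · rank 4 · open · by planner — informal only, no Lean statement yet: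
--   [crux] (rank 4; the component class exposed by the refutation of LambdaTypeSeeds
--   (stmt-Langlands-14580) = the pivot pre-registered in the route's KILL CRITERIA: "pivot that
--   component class to the ramified method of #2") NON-ORDINARY COMPONENTS OF RESIDUALLY REDUCIBLE
--   DEFORMATION SPACES. Setting: p ≥ 5, K = Q_{p^f} unramified, census range f ≤ 2, λ = (0, k_τ−1)_τ
--   regular, k_τ UNBOUNDED, X_λ(ρ̄) := Spec R^{□,cris,λ}(ρ̄)[1/p] ⊗ Q̄_p, ρ̄ : G_K → GL₂(F̄_p) REDUCIBLE
--   (split or not). IN PRINT: (i) the cr-ordinary locus of X_λ(ρ̄) (a G_K-stable line whose character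
--   has the top weight at every τ) is a

-- item stmt-Langlands-14643 · support · rank 7 · open · by planner — informal only, no Lean statement yet:
--   [crux] (rank 7; the thesis X — conjunction node of TrivialFieldReachability and LambdaTypeSeeds,
--   plus families for f >= 3) PD FOR GL_2 OVER UNRAMIFIED p-ADIC FIELDS IN ALL WEIGHTS. For every prime
--   p >= 5 and every finite unramified K/Q_p, every crystalline rho : G_K -> GL_2(Qbar_p) with regular
--   labelled Hodge–Tate weights (HT_tau(rho) of two distinct integers for every tau) is potentially
--   diagonalisable in the sense of BarnetlambEtAl2014 §1.4 (Literature: IsPotentiallyDiagonalizable,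
--   relative to crystalline extension data). KNOWN SUB-CASES (become support when cited as facts): an
--   invariant lin

/-- item stmt-Langlands-12044 · support · rank 9 · open · by planner
sources: Kisin2009, arXiv:1209.5205, arXiv:1309.1658, Rozensztajn2020
[support] the target slice when p SPLITS COMPLETELY in F (every F_v = ℚ_p): KNOWN in print — Kisin's
Fontaine–Mazur theorem for GL₂ over totally real fields in which p splits completely (Kisin2009),
the residually non-generic cases at p removed by the Breuil–Mézard theorems of Paškūnas
(arXiv:1209.5205) and Hu–Tan (arXiv:1309.1658) for p ≥ 5. Calibration anchor; a specialisation of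
LiftB2Unram (Sketch.lean `splitP_of_target`) and of LiftB2UnramSmallF. Also reachable by the census:
it is the f = 1 case, where SeedsOverQp2 is exactly what PD needs. [difficulty: XL] -/
@[route_item "route-Langlands-WachComponentCensus", crux]
def LiftB2UnramSplitP : Prop :=
  ∀ (F : Type) [Field F] [NumberField F] [NumberField.IsTotallyReal F] (p : ℕ) [Fact p.Prime], 7 ≤ p → ¬ ((p : ℤ) ∣ NumberField.discr F) → (∀ v : IsDedekindDomain.HeightOneSpectrum (NumberField.RingOfIntegers F), ((p : ℕ) : NumberField.RingOfIntegers F) ∈ v.asIdeal → v.residueCard = p) → ∃ RD : ReciprocityData F, (∀ (m : ℤ) (χ : Literature.NumberTheory.GaloisRepresentations.FramedGaloisRep F (PadicAlgCl p) 1), (∀ σ, (χ σ).val 0 0 = algebraMap ℚ_[p] (PadicAlgCl p) ((((Literature.NumberTheory.GaloisRepresentations.GaloisRep.cyclotomicCharacter F p σ : ℤ_[p]ˣ) : ℤ_[p]) : ℚ_[p]) ^ m)) → ∀ (v : IsDedekindDomain.HeightOneSpectrum (NumberField.RingOfIntegers F)) (hv : ((p : ℕ) : NumberField.RingOfIntegers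 F) ∈ v.asIdeal), let D := RD.pst p v hv; letI := D.algebra; ∀ τ : v.adicCompletion F →ₐ[ℚ_[p]] PadicAlgCl p, χ.labelledHodgeTateWeightsAt v D.algebra D.𝔅 τ.toRingHom = {-m}) ∧ ∀ hcpt : Literature.NumberTheory.Automorphic.isCompact_glFiniteIntegralLevel 2 F, (∀ π : Literature.NumberTheory.Automorphic.CuspidalAutomorphicRepData 2 F hcpt, π.1.IsLAlgebraic → (∃ T : Literature.NumberTheory.Automorphic.InfinityType F 2, π.1.HasInfinityType T ∧ T.IsRegular) → ∀ (ℓ : ℕ) [Fact ℓ.Prime] (ι : PadicAlgCl ℓ ≃+* ℂ), ∃ ρ : Literature.NumberTheory.GaloisRepresentations.FramedGaloisRep F (PadicAlgCl ℓ) 2, ρ.toGaloisRep.IsIrreducible ∧ IsGeometricFramed RD ρ ∧ Corresponds RD ι π.1 ρ) ∧ (∀ (ι : PadicAlgCl p ≃+* ℂ) (ρ : Literature.NumberTheory.GaloisRepresentations.FramedGaloisRep F (PadicAlgCl p) 2), ρ.toGaloisRep.IsIrreducible → IsGeometricFramed RD ρ → ρ.IsOdd → (∀ (v : IsDedekindDomain.HeightOneSpectrum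 (NumberField.RingOfIntegers F)) (hv : ((p : ℕ) : NumberField.RingOfIntegers F) ∈ v.asIdeal), let D := RD.pst p v hv; D.IsCrystallineFramed (ρ.toLocal v) ∧ (letI := D.algebra; ∀ τ : v.adicCompletion F →ₐ[ℚ_[p]] PadicAlgCl p, let M := ρ.labelledHodgeTateWeightsAt v D.algebra D.𝔅 τ.toRingHom; M.Nodup ∧ Multiset.card M = 2)) → (¬ ∃ χ₁ χ₂ : Field.absoluteGaloisGroup (CyclotomicField p F) →* (PadicAlgCl p)ˣ, IsOpen (χ₁.ker : Set (Field.absoluteGaloisGroup (CyclotomicField p F))) ∧ IsOpen (χ₂.ker : Set (Field.absoluteGaloisGroup (CyclotomicField p F))) ∧ ∀ σ, ‖(ρ.restrictField (CyclotomicField p F) σ).val.trace - ((χ₁ σ : PadicAlgCl p) + (χ₂ σ : PadicAlgCl p))‖ < 1) → (∃ (π₀ : Literature.NumberTheory.Automorphic.CuspidalAutomorphicRepData 2 F hcpt) (ρ₀ : Literature.NumberTheory.GaloisRepresentations.FramedGaloisRep F (PadicAlgCl p) 2), π₀.1.IsLAlgebraic ∧ (∃ T : Literature.NumberTheory.Automorphic.InfinityType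 F 2, π₀.1.HasInfinityType T ∧ T.IsRegular) ∧ Corresponds RD ι π₀.1 ρ₀ ∧ ∀ σ, ‖(ρ σ).val.trace - (ρ₀ σ).val.trace‖ < 1) → ∃ π : Literature.NumberTheory.Automorphic.CuspidalAutomorphicRepData 2 F hcpt, π.1.IsLAlgebraic ∧ Corresponds RD ι π.1 ρ)

-- earlier CanonicalReciprocityData (stmt-Langlands-17924, replaced 2026-08-17T05:18:13Z -> stmt-Langlands-17930): retired by None — ∀ (F : Type) [Field F] [NumberField F], Nonempty (ReciprocityData F)
/-- item stmt-Langlands-17930 · support · rank 9 · open · by planner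
why it might fail: auto-crux — conjecture-grade statement (docstring avows it ('conjecture')); it is open, so it may simply be false
sources: HarrisTaylorAMS2001, HenniartInventiones2000, DeligneAntwerpII1973, SerreLocalFields1979, Literature.NumberTheory.GaloisRepresentations.canonicalArtin
[support] THE SUMMIT'S NON-VACUITY CONJUNCT, verbatim (statement revision p141787, 2026-08-17:
`Langlands := ∀ F, Nonempty (ReciprocityData F) ∧ ∀ 𝓡 n, 0 < n → ∀ hcpt, GLC n F 𝓡 hcpt`, with
`ReciprocityData` pinned to THE local Artin maps by `llc_isCanonical` / `llc_eps_isCanonical`),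
filed by route-repair 5a1bd9af as the explicit INPUT of this route's `∃ RD`-shaped slices
(LiftB2Unram, LiftB2UnramSmallF, LiftB2UnramLargeF, LiftB2UnramSplitP): for every number field F and
every finite place v, a local Langlands datum for GL_n(F_v) (Harris–Taylor 2001 Thm A; Henniart 2000
Thm 1.2) normalised against THE local Artin map `canonicalArtin (F_v)`, whose ε-system (Deligne 1973
Thm 4.1) is normalised against the canonical Artin map of every finite E/F_v. IN PRINT,
textbook-grade input (Harris–Taylor's Thm A is stated relative to Art_K of local class field
theory); in the TREE not yet derivable — `LocalLanglandsDatum.nonempty` (cite-only) yields a datum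
with SOME lawful Artin normalisation, and canonicity needs `IsLocalArtinMap.unique` + the
finite-level reciprocity law for that datum's Artin maps, or canonical variants of
`localLanglands_gl` / `nonempty_localEpsilonSystem` (needs-fact for -/
@[route_item "route-Langlands-WachComponentCensus"]
def CanonicalReciprocityData : Prop :=
  ∀ (F : Type) [Field F] [NumberField F], Nonempty (Summit.Langlands.ReciprocityData F)

/-- item stmt-Langlands-12046 · assembly · rank 1 · closed · proved by Summit.Langlands.Langlands.Theorems.wachComponentCensus_assembly_proof (prover) · by planner
sources: BarnetlambEtAl2014, Kisin2007
[assembly] LiftB2UnramSmallF → LiftB2UnramLargeF → LiftB2Unram (case split on the residue degrees of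
the places above p). -/
@[route_item "route-Langlands-WachComponentCensus"]
def Assembly : Prop :=
  LiftB2UnramSmallF → LiftB2UnramLargeF → LiftB2Unram

-- `Assembly` holds: proved by `Summit.Langlands.Langlands.Theorems.wachComponentCensus_assembly_proof` (its module imports this route file, so no `_holds` link can be stated here).

-- records of items no longer active in this route (dropped / restated):
-- earlier Assembly2 (stmt-Langlands-14681, dropped 2026-08-16T14:43:07Z): moot by None — [support] (rank 9; the MATHEMATICAL assembly — every arrow in print except the two conjectural inputs TrivialFieldReachability / LambdaTypeSeeds; cite items to be filed by grounders as facts land) PD CHAIN. (1) LOCAL CALCULUS (BarnetlambEtAl2014 §1.2–1.4, arXiv:1010.2561 pp. 9–15 READ; Kisin2007 Thm 3.3.8): x, y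

/-! D-0027 §2.1 — DECIDING THEOREM (planner-authored via `route open/edit --closes-file`; by planner-rrepair-Langlands-WachComponentCensus--5a1bd9af-0 2026-08-17T05:07:50Z):
its hypotheses are this route's items and its conclusion the sub-problem Statement (glue_lint), and it elaborates with this file. -/

/-- D-0027 §2.1 deciding theorem of route WachComponentCensus (crux-only form, route-repair 2026-08-16;
re-certified after the statement revision p141787 of 2026-08-17, route-repair 5a1bd9af):
hypotheses = the two typed CRUX slices `LiftB2UnramSmallF` (every v ∣ p of residue degree ≤ 2) and
`LiftB2UnramLargeF` (some v ∣ p of residue degree ≥ 3), which partition the target `LiftB2Unram` by a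
case split on the residue fields above p (carried out inside this proof — the bookkeeping item
`Assembly : LiftB2UnramSmallF → LiftB2UnramLargeF → LiftB2Unram` is not a hypothesis), and the
declared remainder `SliceToLanglands : LiftB2Unram → Langlands` (the rest of GL_n reciprocity, kind
crux, rank 9, not claimed by the thesis). The target `LiftB2Unram` is DERIVED here, not assumed.
STATEMENT REVISION p141787 (`Langlands` := `∀ F, Nonempty (ReciprocityData F) ∧ ∀ 𝓡 n, 0 < n → ∀ hcpt,
GLC n F 𝓡 hcpt`; `ReciprocityData` pinned to the canonical Artin maps): this route reaches the summit
ONLY through `SliceToLanglands`, which names `Langlands` itself, so the remainder now also carries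
(i) the non-vacuity conjunct `Nonempty (ReciprocityData F)` for every number field — canonically
normalised local Langlands data at every completion (Harris–Taylor Thm A / Henniart, against
`canonicalArtin`); for totally real `F` it is moreover witnessed by the `∃ RD` of `LiftB2Unram` at any
prime `p ≥ 7` unramified in `F` — and (ii) the transport of the slice's conclusion from ITS reciprocity
data `RD` to EVERY `𝓡` (`ReciprocityData.artin_eq` / `eps_artin_eq` + Henniart's uniqueness of
`rec_v`). The Wach/Breuil–Kisin census proves neither; both are inputs of GL_n reciprocity at large,
exactly the declared content of the remainder. No `IsFontaineDatum` is built by this route (F8/F11 are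
consumed only through the pinned `RD.pst`, whose cyclotomic pin conjunct is clause (F11)). -/
@[closes "route-Langlands-WachComponentCensus"] theorem closes (hS : LiftB2UnramSmallF) (hL : LiftB2UnramLargeF) (hJ : SliceToLanglands) :
    _root_.Langlands := by
  refine hJ ?_
  intro F _ _ _ p _ hp hdisc
  by_cases h : ∀ v : IsDedekindDomain.HeightOneSpectrum (NumberField.RingOfIntegers F),
      ((p : ℕ) : NumberField.RingOfIntegers F) ∈ v.asIdeal → v.residueCard ≤ p ^ 2
  · exact hS F p hp hdisc h
  · simp only [not_forall, not_le, exists_prop] at h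
    exact hL F p hp hdisc h

end Summit.Langlands.Langlands.Theses.WachComponentCensus
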